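import Summits.BirchSwinnertonDyer.Rank1Residual.P2.ShuZhaiTwoFiftySixAdmissible
import Summits.BirchSwinnertonDyer.Rank1Residual.P2.ShuZhaiCMBaseTransport
import Summits.BirchSwinnertonDyer.Rank1Residual.WAll.TargetCMTwoRamifiedShuZhaiTwoFiftySix
import HarnessLib

/-!
# Cell `bsd-print-cf2` (D-0131 (2) PRINT TIER, leaf CornerF @ `p = 2`), seat p2 — the Shu–Zhai 2021 twist
# family of `256c1` (`y² = x³ + 2p²M²x`; `j = 1728`, `K = ℚ(i)`, `2` RAMIFIED) as a BY-NAME SLICE of the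
# W-ALL leaf `WAllCornerFTwo`: `ord_{s=1} L = 1 ∧ BSD(·, 2)` on every globally minimal model and on the whole
# `ℚ`-isogeny class, `Ш` odd with `ord₂(L′/ΩR) = #Q`; the CLOSER of the leaf `WAllCornerFTwoRamifiedShuZhaiTwoFiftySix`

HONEST FRAMING (cell `bsd-print-cf2`, run/shared/lean/pub/bsd-print-cf2/). The leaf
`Summit.BirchSwinnertonDyer.WAllCornerFTwo` (every CM curve of analytic rank one satisfies Miller's `BSD(E,2)`)
is OPEN AS A CLASS; its ramified type is crux stmt-BirchSwinnertonDyer-20509 `RamifiedOffTYZOfFacts` of route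
`PrintCf2` off the congruent-number families. This file closes nothing class-wide and introduces NO definition
and NO named fact. It reads ONE printed theorem on the leaf:

> Shu–Zhai, *Generalized Birch lemma and the 2-part of the Birch and Swinnerton-Dyer conjecture for certain
> elliptic curves*, J. reine angew. Math. 775 (2021) 117–143, Thm 1.2 + Thm 1.4 (= Thm 4.10), at the optimal
> CM curve `E₀ = 256c1 : y² = x³ + 2x` (Cremona 1992 Table 1: optimal, `|T| = 2`; Table 4:
> `L(E₀,1)/Ω = 1/2`, i.e. `f([0]) = (0,0) ∉ 2E₀(ℚ)`; cell dossier DOSSIER.md §16, lit g3).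

THE FAMILY: `W_{p,M} = E₀^{(−pM)} : y² = x³ + 2p²M²x`, `p ≡ 7 (mod 8)` prime (Heegner for `(E₀, ℚ(√−p))`: `2`
splits), `M = q₁ ⋯ q_r`, `qᵢ ≡ 5 (mod 8)` distinct (admissible: inert in `ℚ(E₀[2]) = ℚ(√−2)` and
`ℚ(E₀′[2]) = ℚ(√2)`, `E₀′ = y² = x³ − 8x`), `r = #Q` EVEN (`M ≡ 1 (mod 8)`: `2` splits in `ℚ(√M)`). Thm 1.2:
`ord_{s=1} L = rk = 1`; Thm 4.10: `Ш` finite of odd order, `ord₂(L′/(ΩR)) = r`; Thm 1.4: BSD(·,2) from BSD(`E₀`,2) = the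
CM rank-ZERO row C8 (Rubin / Burungale–Flach; `L(E₀,1) ≠ 0` is Thm 1.2 at `r = 0`). DISCHARGED IN THE KERNEL:
everything in `Thm12Setting E₀ Dt E₀′ p Q` but the two displays (typer ty2, `P2/ShuZhaiTwoFiftySixCurve.lean` +
`…Admissible.lean`: isogeny, (Tor), `N ∣ 2⁸`, Heegner / (ii) at `ℚ(√−p)`, admissibility, the `ℚ(√M)` condition);
CM and `2` ramified for every model / isogenous curve; the base certificate BSD(`E₀`,2) and the Manin line (seat
p2, `P2/ShuZhaiCMBaseTransport.lean`). EXPLICIT HYPOTHESES (nothing hidden): `thm12_ranks_of_twists` (`h12`),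
`thm14_twoPartBSD_of_twists` (`h14`), `thm410_twoAdicValuations_of_twists` (`h410`, §3 only),
`bsdTriple_of_hasCM_of_L_one_ne_zero` (`hCM`), `hasEntireLFunction_rat` (`hmod`), `bsdRHS_eq_of_isIsogenous`
(`hCassels`, isogeny-class forms), `AgasheRibetStein2006.cremona_abs_maninConstant_eq_one_of_level_le` (`hARS`),
and the base entry `ShuZhai2021.base256c1_optimal_cuspZero` (`hbase`; TABLE-COMPOSITE, lit g3 p548891) — or, in
the `Dt` forms, the displays `hopt`/`hcusp`/`hc`.

Seat p2's sentence: «2-descent matrix road … + Coates–Li–Tian–Zhai 2015 / Zhao 2-adic valuation of L(E,1)/Ω ⇒ 2-part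
of BSD family-wide» — Shu–Zhai 2021 is the rank-ONE sequel of CLTZ15 (2-isogeny descent with admissible primes +
Zhao induction on 2-adic valuations); §3 is its printed 2-adic valuation. REPORT «beyond-print theorem: NO» (print,
read on the leaf). Numerics (kit j284797, evidence on crux 20509): the 36 members `p ≤ 199`, `Q ⊂ {5,13,29,37}`,
`#Q ∈ {0,2}` all have `r_an = 1`, `2`-descent rank bounds `[1,1]`, and — where a generator was found (23/36) —
`Ш_an ∈ {1, 9}` and `ord₂(L′/ΩR) = #Q` exactly.

Contents: §1 base; §2 twists (as printed / `r = 0` / explicit, both `#Q % 2 = 0` and `∏ q ≡ 1 (8)` clauses /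
isogeny class); §3 Thm 4.10; §4 everything BY NAME on `P2.IsShuZhaiTwoFiftySixTwist` /
`P2.IsIsogenousToShuZhaiTwoFiftySixTwist` (`WAll/TargetCMTwoRamifiedShuZhaiTwoFiftySix.lean`), `Ш(W)[2^∞] = 0`,
placement; §5 LEAF SHAPE, the consequent of aside stmt-BirchSwinnertonDyer-21183 literally, and the closer
`Summit.BirchSwinnertonDyer.wAllCornerFTwoRamifiedShuZhaiTwoFiftySix_of_facts`.

References: [ShuZhai2021] Thm 1.2, Def 1.1, Thm 1.4, Thm 4.10 (arXiv:2102.11808 chunks p0003 L3–L45, p0013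
L14–L26); [Cremona1997] Table 1 (256C1), Table 4 (256C); [BurungaleFlach2024] Thm 1.1 + Cor 2;
[AgasheRibetStein2006] Thm 2.6; [MilneADT2006] Thm I.7.3; [Miller2011LMS] Def 1.1; [SilvermanAEC2009] X.5
Cor 5.4, Cor III.9.4; tree files cited inline.
-/

noncomputable section

open scoped Classical

open WeierstrassCurve NumberField Literature.NumberTheory.EllipticCurves
  Literature.NumberTheory.EllipticCurves.Rank1Residual
  Literature.NumberTheory.EllipticCurves.ModularForms
  Literature.NumberTheory.EllipticCurves.ShuZhai2021
  Summit.BirchSwinnertonDyer.Rank1Residual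

set_option autoImplicit false

namespace Summit.BirchSwinnertonDyer.Rank1Residual.P2

/-! ## §1 The base pair `(256c1, 2)`: analytic rank `0` (Thm 1.2 at `r = 0`) and `BSD(256c1, 2)` (row C8) -/

/-- **`ord_{s=1} L(256c1, s) = 0` and `BSD(256c1, 2)`**, DERIVED: the rank from Shu–Zhai Thm 1.2 at `r = 0`
(`h12`; "`f([0]) ∉ 2E(ℚ)` forces `L(E,1) ≠ 0`"), given the two displays and one prime `p ≡ 7 (mod 8)`; `BSD(256c1,2)`
is then row C8 (`hCM`, `hmod`). [cite: ShuZhai2021, Thm. 1.2] [cite: BurungaleFlach2024, Cor. 2] [cite: Miller2011LMS, Def. 1.1] -/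
theorem analyticRank_eq_zero_and_bsdp_two_curve256c1 (h12 : thm12_ranks_of_twists)
    (hCM : bsdTriple_of_hasCM_of_L_one_ne_zero) (hmod : hasEntireLFunction_rat)
    (Dt : ModularParametrizationData curve256c1 (curve256c1.conductorNorm ℤ))
    (hopt : IsOptimalDatum curve256c1 Dt) (hcusp : CuspZeroNotInTwice curve256c1 Dt)
    {p : ℕ} (hp : p.Prime) (h8 : p % 8 = 7) : curve256c1.analyticRank = 0 ∧ BSDp curve256c1 2 :=
  analyticRank_eq_zero_and_bsdp_of_shuZhai_of_hasCM h12 hCM hmod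
    (thm12Setting_curve256c1 Dt hopt hcusp hp h8 (Q := ∅) (fun q hq => absurd hq (Finset.notMem_empty q)))
    hasCM_curve256c1 2

/-! ## §2 The twists `E₀^{(−pM)}`: `ord_{s=1} L = 1 ∧ BSD(·, 2)` on every globally minimal model -/

/-- **`2`-PART OF BSD FOR THE SHU–ZHAI TWISTS OF `256c1` (rank one), AS PRINTED.** Granted BY NAME Shu–Zhai Thm
1.2 (`h12`) and Thm 1.4 (`h14`), row C8 (`hCM`) and modularity (`hmod`); granted AS PRINTED the optimal
parametrisation datum `Dt` of `256c1` with `f([0]) ∉ 2E₀(ℚ)` and odd Manin constant (`hc`): for every prime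
`p ≡ 7 (mod 8)`, every finite set `Q` of admissible primes `≠ p` with every prime of `2N` split in `ℚ(√M)`,
`M = ∏ q*`, and EVERY globally minimal model `W` of `E₀^{(−pM)}`: `ord_{s=1} L(W,s) = 1` and `BSD(W,2)`. The kernel
supplies the setting (ty2's `thm12Setting_curve256c1`), the `ℚ(√−p)`-condition for `2N` and the base
certificate (`P2.analyticRank_eq_one_and_bsdp_two_of_rankOneTwist_of_hasCM`).
[cite: ShuZhai2021, Thm. 1.2, Thm. 1.4 and Thm. 4.10 (arXiv:2102.11808 chunks p0003 L24–L45, p0013 L14–L26)]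
[cite: BurungaleFlach2024, Cor. 2] [cite: Miller2011LMS, Def. 1.1] -/
theorem analyticRank_eq_one_and_bsdp_two_of_twist_curve256c1 (h12 : thm12_ranks_of_twists)
    (h14 : thm14_twoPartBSD_of_twists) (hCM : bsdTriple_of_hasCM_of_L_one_ne_zero)
    (hmod : hasEntireLFunction_rat)
    (Dt : ModularParametrizationData curve256c1 (curve256c1.conductorNorm ℤ))
    (hopt : IsOptimalDatum curve256c1 Dt) (hcusp : CuspZeroNotInTwice curve256c1 Dt) (hc : ¬ (2 : ℤ) ∣ Dt.c)
    {p : ℕ} (hp : p.Prime) (h8 : p % 8 = 7) {Q : Finset ℕ}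
    (hQ : ∀ q ∈ Q, IsAdmissible curve256c1 (⟨0, 0, 0, -8, 0⟩ : WeierstrassCurve ℚ) q ∧ q ≠ p)
    (hQM : AllPrimesSplitInSqrt (2 * curve256c1.conductorNorm ℤ) (∏ q ∈ Q, qStar q))
    (W : WeierstrassCurve ℚ) [W.IsElliptic] [W.IsGloballyMinimal]
    (hW : ∃ C : VariableChange ℚ,
      C • curve256c1.quadraticTwist ((-(p : ℤ) * ∏ q ∈ Q, qStar q : ℤ) : ℚ) = W) :
    W.analyticRank = 1 ∧ BSDp W 2 :=
  analyticRank_eq_one_and_bsdp_two_of_rankOneTwist_of_hasCM h12 h14 hCM hmod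
    (thm12Setting_curve256c1 Dt hopt hcusp hp h8 hQ) hasCM_curve256c1 hc
    (allPrimesSplitInSqrt_two_mul_conductorNorm_curve256c1 hp h8) hQM W hW

/-- **The `r = 0` sub-family: `E₀^{(−p)} ≅ y² = x³ + 2p²x`, `p ≡ 7 (mod 8)` prime** — NO admissibility datum:
`ord_{s=1} L(W,s) = 1` and `BSD(W, 2)` for every globally minimal model `W`. (Smallest member `p = 7`:
`y² = x³ + 98x`, `N = 12544`.) [cite: ShuZhai2021, Thm. 1.2, Thm. 1.4 (r = 0)] [cite: BurungaleFlach2024, Cor. 2] -/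
theorem analyticRank_eq_one_and_bsdp_two_of_twist_curve256c1_prime (h12 : thm12_ranks_of_twists)
    (h14 : thm14_twoPartBSD_of_twists) (hCM : bsdTriple_of_hasCM_of_L_one_ne_zero)
    (hmod : hasEntireLFunction_rat)
    (Dt : ModularParametrizationData curve256c1 (curve256c1.conductorNorm ℤ))
    (hopt : IsOptimalDatum curve256c1 Dt) (hcusp : CuspZeroNotInTwice curve256c1 Dt) (hc : ¬ (2 : ℤ) ∣ Dt.c)
    {p : ℕ} (hp : p.Prime) (h8 : p % 8 = 7)
    (W : WeierstrassCurve ℚ) [W.IsElliptic] [W.IsGloballyMinimal]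
    (hW : ∃ C : VariableChange ℚ, C • curve256c1.quadraticTwist (-(p : ℚ)) = W) :
    W.analyticRank = 1 ∧ BSDp W 2 := by
  refine analyticRank_eq_one_and_bsdp_two_of_twist_curve256c1 h12 h14 hCM hmod Dt hopt hcusp hc hp h8
    (Q := ∅) (fun q hq => absurd hq (Finset.notMem_empty q)) (allPrimesSplitInSqrt_prod_empty _) W ?_
  simpa using hW

/-- **The EXPLICIT two-parameter family**: `p ≡ 7 (mod 8)` prime, `Q` any finite set of primes `q ≡ 5 (mod 8)`
of EVEN cardinality, twist `E₀^{(−p∏q)} ≅ y² = x³ + 2p²M²x` (`M = ∏ q`): `ord_{s=1} L(W,s) = 1` and `BSD(W, 2)` for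
every globally minimal model `W` — admissibility and the `ℚ(√M)`-condition discharged (ty2's
`admissible_curve256c1_of_forall_mod_eight`, `allPrimesSplitInSqrt_two_mul_conductorNorm_prod_curve256c1`).
[cite: ShuZhai2021, Thm. 1.2, Thm. 1.4, Def. 1.1] [cite: BurungaleFlach2024, Cor. 2] -/
theorem analyticRank_eq_one_and_bsdp_two_of_twist_curve256c1_explicit (h12 : thm12_ranks_of_twists)
    (h14 : thm14_twoPartBSD_of_twists) (hCM : bsdTriple_of_hasCM_of_L_one_ne_zero)
    (hmod : hasEntireLFunction_rat)
    (Dt : ModularParametrizationData curve256c1 (curve256c1.conductorNorm ℤ))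
    (hopt : IsOptimalDatum curve256c1 Dt) (hcusp : CuspZeroNotInTwice curve256c1 Dt) (hc : ¬ (2 : ℤ) ∣ Dt.c)
    {p : ℕ} (hp : p.Prime) (h8 : p % 8 = 7)
    {Q : Finset ℕ} (hQ : ∀ q ∈ Q, q.Prime ∧ q % 8 = 5) (heven : Q.card % 2 = 0)
    (W : WeierstrassCurve ℚ) [W.IsElliptic] [W.IsGloballyMinimal]
    (hW : ∃ C : VariableChange ℚ, C • curve256c1.quadraticTwist (-((p * ∏ q ∈ Q, q : ℕ) : ℚ)) = W) :
    W.analyticRank = 1 ∧ BSDp W 2 := by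
  refine analyticRank_eq_one_and_bsdp_two_of_twist_curve256c1 h12 h14 hCM hmod Dt hopt hcusp hc hp h8
    (admissible_curve256c1_of_forall_mod_eight h8 hQ)
    (allPrimesSplitInSqrt_two_mul_conductorNorm_prod_curve256c1 hQ heven) W ?_
  rw [prod_qStar_eq_of_forall_mod_eight hQ]
  push_cast at hW ⊢
  simpa [neg_mul] using hW

/-- Under `q ≡ 5 (mod 8)` for all `q ∈ Q`: `∏ q ≡ 1 (mod 8)` iff `#Q` is even (ty2's
`prod_mod_eight_of_forall_mod_eight`) — the membership clause of the planner's aside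
`RamifiedShuZhaiTwoFiftySixOfFactsPlus` (stmt-BirchSwinnertonDyer-21183) versus the `#Q % 2 = 0` clause of
`P2.IsShuZhaiTwoFiftySixTwist`. [folklore] -/
theorem card_mod_two_eq_zero_iff_prod_mod_eight_eq_one {Q : Finset ℕ} (hQ : ∀ q ∈ Q, q.Prime ∧ q % 8 = 5) :
    Q.card % 2 = 0 ↔ (∏ q ∈ Q, q) % 8 = 1 := by
  rw [prod_mod_eight_of_forall_mod_eight hQ]
  by_cases h : Q.card % 2 = 0
  · rw [if_pos h]; exact ⟨fun _ => rfl, fun _ => h⟩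
  · rw [if_neg h]; exact ⟨fun h' => absurd h' h, fun h' => absurd h' (by norm_num)⟩

/-- **The EXPLICIT family, `∏ q ≡ 1 (mod 8)` form** (the membership clause of aside stmt-BirchSwinnertonDyer-21183):
`ord_{s=1} L(W,s) = 1 ∧ BSD(W,2)` for every globally minimal model `W` of `E₀^{(−p∏q)}`, `p ≡ 7 (mod 8)` prime,
`Q ⊂ {primes ≡ 5 (mod 8)}`, `∏ q ≡ 1 (mod 8)`. [cite: ShuZhai2021, Thm. 1.2, Thm. 1.4, Def. 1.1] [cite: BurungaleFlach2024, Cor. 2] -/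
theorem analyticRank_eq_one_and_bsdp_two_of_twist_curve256c1_explicit' (h12 : thm12_ranks_of_twists)
    (h14 : thm14_twoPartBSD_of_twists) (hCM : bsdTriple_of_hasCM_of_L_one_ne_zero)
    (hmod : hasEntireLFunction_rat)
    (Dt : ModularParametrizationData curve256c1 (curve256c1.conductorNorm ℤ))
    (hopt : IsOptimalDatum curve256c1 Dt) (hcusp : CuspZeroNotInTwice curve256c1 Dt) (hc : ¬ (2 : ℤ) ∣ Dt.c)
    {p : ℕ} (hp : p.Prime) (h8 : p % 8 = 7)
    {Q : Finset ℕ} (hQ : ∀ q ∈ Q, q.Prime ∧ q % 8 = 5) (hM : (∏ q ∈ Q, q) % 8 = 1)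
    (W : WeierstrassCurve ℚ) [W.IsElliptic] [W.IsGloballyMinimal]
    (hW : ∃ C : VariableChange ℚ, C • curve256c1.quadraticTwist (-((p * ∏ q ∈ Q, q : ℕ) : ℚ)) = W) :
    W.analyticRank = 1 ∧ BSDp W 2 :=
  analyticRank_eq_one_and_bsdp_two_of_twist_curve256c1_explicit h12 h14 hCM hmod Dt hopt hcusp hc hp h8 hQ
    ((card_mod_two_eq_zero_iff_prod_mod_eight_eq_one hQ).2 hM) W hW

/-- **The EXPLICIT family on the `ℚ`-ISOGENY CLASS** (Cassels' invariance `hCassels` BY NAME; the class of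
`y² = x³ + 2p²M²x` also contains `y² = x³ − 8p²M²x`): every globally minimal `W` `ℚ`-isogenous to `E₀^{(−p∏q)}` has
`ord_{s=1} L = 1` and `BSD(W,2)`. [cite: ShuZhai2021, Thm. 1.2, Thm. 1.4] [cite: MilneADT2006, Thm. I.7.3]
[cite: BurungaleFlach2024, Cor. 2] [cite: Miller2011LMS, §1 and Def. 1.1] -/
theorem analyticRank_eq_one_and_bsdp_two_of_isIsogenous_twist_curve256c1_explicit
    (hCassels : bsdRHS_eq_of_isIsogenous) (h12 : thm12_ranks_of_twists)
    (h14 : thm14_twoPartBSD_of_twists) (hCM : bsdTriple_of_hasCM_of_L_one_ne_zero)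
    (hmod : hasEntireLFunction_rat)
    (Dt : ModularParametrizationData curve256c1 (curve256c1.conductorNorm ℤ))
    (hopt : IsOptimalDatum curve256c1 Dt) (hcusp : CuspZeroNotInTwice curve256c1 Dt) (hc : ¬ (2 : ℤ) ∣ Dt.c)
    {p : ℕ} (hp : p.Prime) (h8 : p % 8 = 7)
    {Q : Finset ℕ} (hQ : ∀ q ∈ Q, q.Prime ∧ q % 8 = 5) (heven : Q.card % 2 = 0)
    (W : WeierstrassCurve ℚ) [W.IsElliptic] [W.IsGloballyMinimal]
    (hiso : IsIsogenous W (curve256c1.quadraticTwist (-((p * ∏ q ∈ Q, q : ℕ) : ℚ)))) :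
    W.analyticRank = 1 ∧ BSDp W 2 := by
  refine analyticRank_eq_one_and_bsdp_two_of_isIsogenous_rankOneTwist_of_hasCM hCassels h12 h14 hCM hmod
    (thm12Setting_curve256c1 Dt hopt hcusp hp h8 (admissible_curve256c1_of_forall_mod_eight h8 hQ))
    hasCM_curve256c1 hc (allPrimesSplitInSqrt_two_mul_conductorNorm_curve256c1 hp h8)
    (allPrimesSplitInSqrt_two_mul_conductorNorm_prod_curve256c1 hQ heven) W ?_
  rw [prod_qStar_eq_of_forall_mod_eight hQ]
  push_cast
  simpa [neg_mul] using hiso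

/-! ## §3 Shu–Zhai Thm 4.10 on the family: `Ш` odd, `ord₂(L′/(ΩR)) = #Q` — EVEN -/

/-- **Thm 4.10 on the explicit family** (its valuations are UNCONDITIONAL in print — no base certificate): for
`p ≡ 7 (mod 8)`, `Q ⊂ {primes ≡ 5 (mod 8)}` of even cardinality and every globally minimal model `W` of
`E₀^{(−p∏q)}`: `ord_{s=1} L = rank = 1`, `Ш(W)` FINITE OF ODD ORDER, and `L′(W,1) = x·Ω·R` with `x ∈ ℚ`,
`ord₂ x = #Q` (an EVEN number). Display binders: `h410`, the datum `Dt`/`hopt`/`hcusp`, `hc`.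
[cite: ShuZhai2021, Thm. 4.10 (arXiv:2102.11808 chunk p0013 L14–L26)] -/
theorem sha_odd_and_ordTwo_of_twist_curve256c1_explicit (h410 : thm410_twoAdicValuations_of_twists)
    (Dt : ModularParametrizationData curve256c1 (curve256c1.conductorNorm ℤ))
    (hopt : IsOptimalDatum curve256c1 Dt) (hcusp : CuspZeroNotInTwice curve256c1 Dt) (hc : ¬ (2 : ℤ) ∣ Dt.c)
    {p : ℕ} (hp : p.Prime) (h8 : p % 8 = 7)
    {Q : Finset ℕ} (hQ : ∀ q ∈ Q, q.Prime ∧ q % 8 = 5) (heven : Q.card % 2 = 0)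
    (W : WeierstrassCurve ℚ) [W.IsElliptic] [W.IsGloballyMinimal]
    (hW : ∃ C : VariableChange ℚ, C • curve256c1.quadraticTwist (-((p * ∏ q ∈ Q, q : ℕ) : ℚ)) = W) :
    (W.analyticRank = 1 ∧ W.mordellWeilRank = 1) ∧ (Finite W.sha ∧ Odd (Nat.card W.sha)) ∧
      ∃ x : ℚ, W.leadingLCoeff = (x : ℂ) * (W.realPeriodRat : ℂ) * (W.regulator : ℂ) ∧
        padicValRat 2 x = (Q.card : ℤ) := by
  refine sha_odd_and_ordTwo_of_rankOneTwist h410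
    (thm12Setting_curve256c1 Dt hopt hcusp hp h8 (admissible_curve256c1_of_forall_mod_eight h8 hQ))
    (allPrimesSplitInSqrt_two_mul_conductorNorm_prod_curve256c1 hQ heven) h8 hc W ?_
  rw [prod_qStar_eq_of_forall_mod_eight hQ]
  push_cast at hW ⊢
  simpa [neg_mul] using hW

/-! ## §4 Everything BY NAME on the membership predicates (`hbase := base256c1_optimal_cuspZero`) -/

/-- **`ord_{s=1} L(W,s) = 1 ∧ BSD(W,2)` on the explicit Shu–Zhai family of `256c1`, ENTIRELY BY NAME**: granted
Shu–Zhai Thm 1.2 (`h12`) and Thm 1.4 (`h14`), row C8 (`hCM`), modularity (`hmod`), ARS06 Thm 2.6 (`hARS`, odd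
Manin constant since `N(E₀) ∣ 256`) and the `256c1` base entry (`hbase`: optimal datum with
`f([0]) ∉ 2E₀(ℚ)`). [cite: ShuZhai2021, Thm. 1.2, Thm. 1.4] [cite: Cremona1997, Table 1 (256C1) and Table 4 (256C)]
[cite: AgasheRibetStein2006, Thm. 2.6] [cite: BurungaleFlach2024, Cor. 2] [cite: Miller2011LMS, Def. 1.1] -/
theorem analyticRank_eq_one_and_bsdp_two_of_isShuZhaiTwoFiftySixTwist (h12 : thm12_ranks_of_twists)
    (h14 : thm14_twoPartBSD_of_twists) (hCM : bsdTriple_of_hasCM_of_L_one_ne_zero)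
    (hmod : hasEntireLFunction_rat)
    (hARS : AgasheRibetStein2006.cremona_abs_maninConstant_eq_one_of_level_le)
    (hbase : base256c1_optimal_cuspZero) (W : WeierstrassCurve ℚ) [W.IsElliptic] [W.IsGloballyMinimal]
    (hW : IsShuZhaiTwoFiftySixTwist W) : W.analyticRank = 1 ∧ BSDp W 2 := by
  obtain ⟨_, Dt, hopt, hcusp⟩ := hbase
  obtain ⟨p, Q, C, hp, h8, hQ, heven, hC⟩ := hW
  exact analyticRank_eq_one_and_bsdp_two_of_twist_curve256c1_explicit h12 h14 hCM hmod Dt hopt hcusp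
    (not_two_dvd_c_of_isOptimalDatum_curve256c1 hARS Dt hopt) hp h8 hQ heven W ⟨C, hC⟩

/-- **The same on the `ℚ`-ISOGENY CLASSES, ENTIRELY BY NAME** (plus Cassels `hCassels`).
[cite: ShuZhai2021, Thm. 1.2, Thm. 1.4] [cite: MilneADT2006, Thm. I.7.3] [cite: Cremona1997, Table 1 (256C1) and Table 4 (256C)]
[cite: AgasheRibetStein2006, Thm. 2.6] [cite: BurungaleFlach2024, Cor. 2] -/
theorem analyticRank_eq_one_and_bsdp_two_of_isIsogenousToShuZhaiTwoFiftySixTwist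
    (hCassels : bsdRHS_eq_of_isIsogenous) (h12 : thm12_ranks_of_twists) (h14 : thm14_twoPartBSD_of_twists)
    (hCM : bsdTriple_of_hasCM_of_L_one_ne_zero) (hmod : hasEntireLFunction_rat)
    (hARS : AgasheRibetStein2006.cremona_abs_maninConstant_eq_one_of_level_le)
    (hbase : base256c1_optimal_cuspZero) (W : WeierstrassCurve ℚ) [W.IsElliptic] [W.IsGloballyMinimal]
    (hW : IsIsogenousToShuZhaiTwoFiftySixTwist W) : W.analyticRank = 1 ∧ BSDp W 2 := by
  obtain ⟨_, Dt, hopt, hcusp⟩ := hbase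
  obtain ⟨p, Q, hp, h8, hQ, heven, hiso⟩ := hW
  exact analyticRank_eq_one_and_bsdp_two_of_isIsogenous_twist_curve256c1_explicit hCassels h12 h14 hCM hmod Dt
    hopt hcusp (not_two_dvd_c_of_isOptimalDatum_curve256c1 hARS Dt hopt) hp h8 hQ heven W hiso

/-- **Thm 4.10 BY NAME on the family (models): `Ш(W)` finite of ODD order and `ord₂(L′(W,1)/(ΩR))` EVEN**
(`= #Q`) — granted Thm 4.10 (`h410`), ARS06 (`hARS`) and the base entry (`hbase`).
[cite: ShuZhai2021, Thm. 4.10] [cite: Cremona1997, Table 1 (256C1) and Table 4 (256C)] [cite: AgasheRibetStein2006, Thm. 2.6] -/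
theorem sha_odd_and_ordTwo_even_of_isShuZhaiTwoFiftySixTwist (h410 : thm410_twoAdicValuations_of_twists)
    (hARS : AgasheRibetStein2006.cremona_abs_maninConstant_eq_one_of_level_le)
    (hbase : base256c1_optimal_cuspZero) (W : WeierstrassCurve ℚ) [W.IsElliptic] [W.IsGloballyMinimal]
    (hW : IsShuZhaiTwoFiftySixTwist W) :
    (W.analyticRank = 1 ∧ W.mordellWeilRank = 1) ∧ (Finite W.sha ∧ Odd (Nat.card W.sha)) ∧
      ∃ x : ℚ, W.leadingLCoeff = (x : ℂ) * (W.realPeriodRat : ℂ) * (W.regulator : ℂ) ∧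
        Even (padicValRat 2 x) := by
  obtain ⟨_, Dt, hopt, hcusp⟩ := hbase
  obtain ⟨p, Q, C, hp, h8, hQ, heven, hC⟩ := hW
  obtain ⟨hr, hsha, x, hx, hv⟩ := sha_odd_and_ordTwo_of_twist_curve256c1_explicit h410 Dt hopt hcusp
    (not_two_dvd_c_of_isOptimalDatum_curve256c1 hARS Dt hopt) hp h8 hQ heven W ⟨C, hC⟩
  refine ⟨hr, hsha, x, hx, ?_⟩
  rw [hv, Int.even_coe_nat, Nat.even_iff]
  exact heven

/-- A finite abelian group of odd order has trivial `2`-primary component (Lagrange). [folklore] -/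
private theorem primaryComponent_two_eq_bot_of_odd_card {A : Type*} [AddCommGroup A] [Finite A]
    (h : Odd (Nat.card A)) : AddCommGroup.primaryComponent A 2 = ⊥ := by
  haveI : Fact (Nat.Prime 2) := ⟨Nat.prime_two⟩
  refine (AddSubgroup.eq_bot_iff_forall _).mpr fun y hy ↦ ?_
  obtain ⟨n, hn⟩ := (AddCommGroup.mem_primaryComponent_iff_addOrderOf (p := 2)).mp hy
  have hdvd : addOrderOf y ∣ Nat.card A := addOrderOf_dvd_natCard y
  rw [hn] at hdvd
  rcases n with _ | n
  · rw [pow_zero] at hn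
    exact AddMonoid.addOrderOf_eq_one_iff.mp hn
  · exact absurd (even_iff_two_dvd.mpr (dvd_trans (dvd_pow_self 2 (Nat.succ_ne_zero n)) hdvd))
      (Nat.not_even_iff_odd.mpr h)

/-- **`Ш(W)[2^∞] = 0` on the family (models), BY NAME** — the `2`-primary component of the Shafarevich–Tate group of
every globally minimal model of a Shu–Zhai twist `256c1^{(−pM)}` is TRIVIAL (Thm 4.10: `Ш` finite of odd order;
`h410`, `hARS`, `hbase`). In the seat's census vocabulary: every member is a rank-one curve with `Ш[2] = 0`
(categories A/B of HOME/bsd-print-cf2-p2/CENSUS-p2-20509.md, but OFF every `E_n`).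
[cite: ShuZhai2021, Thm. 4.10] [cite: Cremona1997, Table 1 (256C1) and Table 4 (256C)] [cite: AgasheRibetStein2006, Thm. 2.6] -/
theorem sha_primaryComponent_two_eq_bot_of_isShuZhaiTwoFiftySixTwist (h410 : thm410_twoAdicValuations_of_twists)
    (hARS : AgasheRibetStein2006.cremona_abs_maninConstant_eq_one_of_level_le)
    (hbase : base256c1_optimal_cuspZero) (W : WeierstrassCurve ℚ) [W.IsElliptic] [W.IsGloballyMinimal]
    (hW : IsShuZhaiTwoFiftySixTwist W) : AddCommGroup.primaryComponent W.sha 2 = ⊥ := by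
  obtain ⟨-, ⟨hfin, hodd⟩, -⟩ := sha_odd_and_ordTwo_even_of_isShuZhaiTwoFiftySixTwist h410 hARS hbase W hW
  haveI := hfin
  exact primaryComponent_two_eq_bot_of_odd_card hodd

/-- **Placement of the family inside the leaf**: every globally minimal model of a member has CM, `2` RAMIFIED
in its CM field, `ord_{s=1} L = 1` (Thm 1.2, `h12`, with the base entry `hbase`), hence `CornerF W 2` — a MEMBER
of the class leaf (PARTITION currency, slice RAM of rung W-ALL/12.K12-2). [cite: ShuZhai2021, Thm. 1.2]
[cite: SilvermanATAEC1994, App. A §3] -/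
theorem placement_of_isShuZhaiTwoFiftySixTwist (h12 : thm12_ranks_of_twists) (hbase : base256c1_optimal_cuspZero)
    (W : WeierstrassCurve ℚ) [W.IsElliptic] [W.IsGloballyMinimal] (hW : IsShuZhaiTwoFiftySixTwist W) :
    W.HasCM ∧ CMRamified W 2 ∧ W.analyticRank = 1 ∧ CornerF W 2 := by
  obtain ⟨hcm, hram⟩ := hasCM_and_cmRamified_two_of_isShuZhaiTwoFiftySixTwist W hW
  obtain ⟨_, Dt, hopt, hcusp⟩ := hbase
  obtain ⟨p, Q, C, hp, h8, hQ, -, hC⟩ := hW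
  have hS := thm12Setting_curve256c1 Dt hopt hcusp hp h8 (admissible_curve256c1_of_forall_mod_eight h8 hQ)
  have hd0 : ((-(p : ℤ) * ∏ q ∈ Q, qStar q : ℤ) : ℚ) ≠ 0 :=
    neg_p_mul_ne_zero_of_thm12Setting hS Q (fun q hq => by exact_mod_cast (hQ q hq).1.ne_zero)
  have hd : ((∏ q ∈ Q, qStar q : ℤ) : ℚ) ≠ 0 := by
    have h := hd0
    push_cast at h ⊢
    exact (mul_ne_zero_iff.mp h).2
  have hW' : ∃ C : VariableChange ℚ,
      C • curve256c1.quadraticTwist ((-(p : ℤ) * ∏ q ∈ Q, qStar q : ℤ) : ℚ) = W := by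
    refine ⟨C, ?_⟩
    rw [prod_qStar_eq_of_forall_mod_eight hQ]
    push_cast at hC ⊢
    simpa [neg_mul] using hC
  obtain ⟨WM, _, _, hWM⟩ := exists_globallyMinimal_twist curve256c1 hd
  obtain ⟨-, -, hr1, -, -, -⟩ := h12 curve256c1 Dt _ p Q hS WM W hWM hW'
  exact ⟨hcm, hram, hr1, CornerFTwo.cornerF_two_iff.mpr ⟨hcm, hr1⟩⟩

/-! ## §5 LEAF SHAPE; the closer of `WAllCornerFTwoRamifiedShuZhaiTwoFiftySix` -/

/-- **SLICE SZ256 BY NAME, membership INLINED with `∏ q ≡ 1 (mod 8)`** — LITERALLY the consequent of the planner's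
aside `RamifiedShuZhaiTwoFiftySixOfFactsPlus` (stmt-BirchSwinnertonDyer-21183, route rev 10), closed granted
`h12 h14 hCM hmod hARS hbase`. beyond-print: NO. [cite: ShuZhai2021, Thm. 1.2, Thm. 1.4]
[cite: Cremona1997, Table 1 (256C1) and Table 4 (256C)] [cite: AgasheRibetStein2006, Thm. 2.6]
[cite: BurungaleFlach2024, Cor. 2] [cite: Miller2011LMS, Def. 1.1] -/
theorem cornerFTwo_shuZhaiTwoFiftySix_byName' (h12 : thm12_ranks_of_twists) (h14 : thm14_twoPartBSD_of_twists)
    (hCM : bsdTriple_of_hasCM_of_L_one_ne_zero) (hmod : hasEntireLFunction_rat)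
    (hARS : AgasheRibetStein2006.cremona_abs_maninConstant_eq_one_of_level_le)
    (hbase : base256c1_optimal_cuspZero) :
    ∀ (W : WeierstrassCurve ℚ) [W.IsElliptic] [W.IsGloballyMinimal], W.HasCM → W.analyticRank = 1 →
      CMRamified W 2 →
      (∃ (p : ℕ) (Q : Finset ℕ) (C : VariableChange ℚ), p.Prime ∧ p % 8 = 7 ∧ (∀ q ∈ Q, q.Prime ∧ q % 8 = 5) ∧
        (∏ q ∈ Q, q) % 8 = 1 ∧ C • curve256c1.quadraticTwist (-((p * ∏ q ∈ Q, q : ℕ) : ℚ)) = W) → BSDp W 2 := by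
  intro W _ _ _ _ _ hW
  obtain ⟨_, Dt, hopt, hcusp⟩ := hbase
  obtain ⟨p, Q, C, hp, h8, hQ, hM, hC⟩ := hW
  exact (analyticRank_eq_one_and_bsdp_two_of_twist_curve256c1_explicit' h12 h14 hCM hmod Dt hopt hcusp
    (not_two_dvd_c_of_isOptimalDatum_curve256c1 hARS Dt hopt) hp h8 hQ hM W ⟨C, hC⟩).2

/-- **SLICE SZ256 BY NAME on the `ℚ`-ISOGENY CLASSES, in the binder shape of crux 20509** (plus Cassels) — this
is `WAllCornerFTwoRamifiedShuZhaiTwoFiftySix` unfolded. beyond-print: NO.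
[cite: ShuZhai2021, Thm. 1.2, Thm. 1.4] [cite: MilneADT2006, Thm. I.7.3] [cite: Cremona1997, Table 1 (256C1) and Table 4 (256C)]
[cite: AgasheRibetStein2006, Thm. 2.6] [cite: BurungaleFlach2024, Cor. 2] [cite: Miller2011LMS, Def. 1.1] -/
theorem cornerFTwo_shuZhaiTwoFiftySix_isogenyClass_byName (hCassels : bsdRHS_eq_of_isIsogenous)
    (h12 : thm12_ranks_of_twists) (h14 : thm14_twoPartBSD_of_twists)
    (hCM : bsdTriple_of_hasCM_of_L_one_ne_zero) (hmod : hasEntireLFunction_rat)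
    (hARS : AgasheRibetStein2006.cremona_abs_maninConstant_eq_one_of_level_le)
    (hbase : base256c1_optimal_cuspZero) :
    ∀ (W : WeierstrassCurve ℚ) [W.IsElliptic] [W.IsGloballyMinimal], W.HasCM → W.analyticRank = 1 →
      CMRamified W 2 → IsIsogenousToShuZhaiTwoFiftySixTwist W → BSDp W 2 :=
  fun W _ _ _ _ _ hW =>
    (analyticRank_eq_one_and_bsdp_two_of_isIsogenousToShuZhaiTwoFiftySixTwist hCassels h12 h14 hCM hmod hARS
      hbase W hW).2

end Summit.BirchSwinnertonDyer.Rank1Residual.P2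

namespace Summit.BirchSwinnertonDyer

/-- **`WAllCornerFTwoRamifiedShuZhaiTwoFiftySix` holds granted, BY NAME: Cassels' isogeny invariance
(`hCassels`), Shu–Zhai 2021 Thm 1.2 (`h12`) and Thm 1.4 (`h14`), the CM rank-zero row C8 (`hCM`,
Burungale–Flach 2024 / Rubin), modularity (`hmod`), Agashe–Ribet–Stein 2006 Thm 2.6 (`hARS`) and the `256c1`
base entry `ShuZhai2021.base256c1_optimal_cuspZero` (`hbase`)** — conjuncts 3, 4, 2 of the route bundle `𝔅_ram`
plus four facts outside it (SZ12, SZ14, ARS06, base), K7t doctrine: aside `RamifiedShuZhaiTwoFiftySixOfFactsPlus`.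
beyond-print: NO. [cite: ShuZhai2021, Thm. 1.2, Thm. 1.4] [cite: Cremona1997, Table 1 (256C1) and Table 4 (256C)]
[cite: MilneADT2006, Thm. I.7.3] [cite: AgasheRibetStein2006, Thm. 2.6] [cite: BurungaleFlach2024, Cor. 2]
[cite: Miller2011LMS, Def. 1.1] -/
theorem wAllCornerFTwoRamifiedShuZhaiTwoFiftySix_of_facts (hCassels : bsdRHS_eq_of_isIsogenous)
    (h12 : thm12_ranks_of_twists) (h14 : thm14_twoPartBSD_of_twists)
    (hCM : bsdTriple_of_hasCM_of_L_one_ne_zero) (hmod : hasEntireLFunction_rat)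
    (hARS : AgasheRibetStein2006.cremona_abs_maninConstant_eq_one_of_level_le)
    (hbase : base256c1_optimal_cuspZero) : WAllCornerFTwoRamifiedShuZhaiTwoFiftySix :=
  fun W _ _ hcm hr1 hram hW ↦
    P2.cornerFTwo_shuZhaiTwoFiftySix_isogenyClass_byName hCassels h12 h14 hCM hmod hARS hbase W hcm hr1 hram hW

/-- **After the facts, the five-way residual of crux 20509 IS the six-way residual**: granted the seven named
facts, `WAllCornerFTwoRamifiedOffTYZOffSMinus ↔ WAllCornerFTwoRamifiedOffTYZOffSMinusOffShuZhai`. [folklore] -/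
theorem wAllCornerFTwoRamifiedOffTYZOffSMinus_iff_offShuZhai_of_facts (hCassels : bsdRHS_eq_of_isIsogenous)
    (h12 : thm12_ranks_of_twists) (h14 : thm14_twoPartBSD_of_twists)
    (hCM : bsdTriple_of_hasCM_of_L_one_ne_zero) (hmod : hasEntireLFunction_rat)
    (hARS : AgasheRibetStein2006.cremona_abs_maninConstant_eq_one_of_level_le)
    (hbase : base256c1_optimal_cuspZero) :
    WAllCornerFTwoRamifiedOffTYZOffSMinus ↔ WAllCornerFTwoRamifiedOffTYZOffSMinusOffShuZhai :=
  ⟨wAllCornerFTwoRamifiedOffTYZOffSMinusOffShuZhai_of_offTYZOffSMinus,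
    wAllCornerFTwoRamifiedOffTYZOffSMinus_of_shuZhai_of_offShuZhai
      (wAllCornerFTwoRamifiedShuZhaiTwoFiftySix_of_facts hCassels h12 h14 hCM hmod hARS hbase)⟩

end Summit.BirchSwinnertonDyer

end
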